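import Mathlib
import Summits.Ventures.DiscreteObjects.Mahler.SubLehmerDegree57

/-!
# An irreducible integer polynomial with a unimodular root is reciprocal (venture `DiscreteObjects`, target L)

Cell `pub-namedobj`, seat `pub-namedobj-mahler` (gen 10). Framing: lottery ticket; floor = certified
bounds/negative ranges.

[McKee–Smyth, *Around the Unit Circle*, Exercise 12.15]: if an irreducible `P ∈ ℤ[z]` has a zero of
modulus `1`, then `P` is self-reciprocal (`P* = ±P`).  With [McKee–Smyth, Exercise A.5]: a self-reciprocal
irreducible integer polynomial is `±(z - 1)`, `±(z + 1)`, or palindromic (`P* = P`) of even degree.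
For the census (target L) this is the structural reason why Salem and cyclotomic factors, and every
irreducible polynomial met on the unit circle, live in the reciprocal search space.

Kernel route: `ᾱ = α⁻¹` is a root of `P`, so `α` is a common root of `P` and `P* = P.reverse`; an
irreducible `P` of positive degree divides every integer polynomial vanishing at one of its roots
(`dvd_of_aeval_eq_zero_of_irreducible`: Gauss's lemma and the minimal polynomial over `ℚ`); comparing
`P ∣ P*` with `deg P* ≤ deg P` and the extreme coefficients gives `P* = ±P`; `P* = -P` forces `P(1) = 0`
and odd degree with `P* = P` forces `P(-1) = 0`.

* `dvd_of_aeval_eq_zero_of_irreducible` — common complex root with an irreducible `P` ⇒ `P ∣ Q`;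
* `aeval_reverse_eq_zero_of_norm_eq_one` — a unimodular root of `P` is a root of `P.reverse`;
* `reverse_eq_or_eq_neg_of_irreducible_of_unimodular_root` — **Exercise 12.15**;
* `reverse_eq_self_of_irreducible_of_unimodular_root` — degree `≥ 2`: `P.reverse = P` and `deg P` even.
-/

namespace Summit.Ventures.DiscreteObjects.Mahler

open Polynomial

/-- **Common root ⇒ divisibility.** If `P ∈ ℤ[X]` is irreducible of positive degree and `α ∈ ℂ` is a
common root of `P` and `Q ∈ ℤ[X]`, then `P ∣ Q` in `ℤ[X]` (the minimal polynomial of `α` over `ℚ` is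
`P/lc(P)` by Gauss's lemma, and divides `Q`). -/
theorem dvd_of_aeval_eq_zero_of_irreducible {P Q : ℤ[X]} (hirr : Irreducible P)
    (hdeg : 0 < P.natDegree) {α : ℂ} (hP : aeval α P = 0) (hQ : aeval α Q = 0) : P ∣ Q := by
  have hprim : P.IsPrimitive := hirr.isPrimitive hdeg.ne'
  have hPQ : Irreducible (P.map (algebraMap ℤ ℚ)) :=
    (hprim.irreducible_iff_irreducible_map_fraction_map (K := ℚ)).mp hirr
  have hαP : aeval α (P.map (algebraMap ℤ ℚ)) = 0 := by rwa [aeval_map_algebraMap]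
  have hmin := minpoly.eq_of_irreducible hPQ hαP
  have hαQ : aeval α (Q.map (algebraMap ℤ ℚ)) = 0 := by rwa [aeval_map_algebraMap]
  have h1 : minpoly ℚ α ∣ Q.map (algebraMap ℤ ℚ) := minpoly.dvd ℚ α hαQ
  have h2 : P.map (algebraMap ℤ ℚ) ∣ Q.map (algebraMap ℤ ℚ) := by
    rw [← hmin] at h1
    exact (dvd_mul_right _ _).trans h1
  exact (hprim.dvd_iff_fraction_map_dvd_fraction_map ℚ).mpr h2

/-- Complex conjugates of roots of an integer polynomial are roots. -/
theorem aeval_conj_eq_zero {P : ℤ[X]} {α : ℂ} (hP : aeval α P = 0) : aeval (starRingEnd ℂ α) P = 0 := by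
  have h := aeval_algHom_apply ((starRingEnd ℂ).toIntAlgHom) α P
  rw [RingHom.toIntAlgHom_apply, hP, map_zero] at h
  exact h

/-- **A unimodular root of `P ∈ ℤ[X]` is a root of `P.reverse`:** if `‖α‖ = 1` and `P(α) = 0` then
`P*(α) = 0`, because `P(α⁻¹) = P(ᾱ) = 0`. -/
theorem aeval_reverse_eq_zero_of_norm_eq_one {P : ℤ[X]} {α : ℂ} (hα : ‖α‖ = 1) (hP : aeval α P = 0) :
    aeval α P.reverse = 0 := by
  have hα0 : α ≠ 0 := by
    intro h
    rw [h, norm_zero] at hα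
    exact zero_ne_one hα
  have hconj : aeval α⁻¹ P = 0 := by
    rw [Complex.inv_eq_conj hα]
    exact aeval_conj_eq_zero hP
  letI : Invertible α := invertibleOfNonzero hα0
  have h := (eval₂_reverse_eq_zero_iff (algebraMap ℤ ℂ) α⁻¹ P).mpr (by rwa [aeval_def] at hconj)
  rwa [invOf_eq_inv, inv_inv, ← aeval_def] at h

/-- If `P ∣ P.reverse` in `ℤ[X]` and `P(0) ≠ 0`, then `P.reverse = ±P`. -/
theorem reverse_eq_or_eq_neg_of_dvd_reverse {P : ℤ[X]} (h0 : P.coeff 0 ≠ 0) (hdvd : P ∣ P.reverse) :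
    P.reverse = P ∨ P.reverse = -P := by
  have hP0 : P ≠ 0 := fun h => h0 (by rw [h, coeff_zero])
  obtain ⟨R, hR⟩ := hdvd
  have hrev0 : P.reverse ≠ 0 := by
    intro h
    have := congrArg (fun p : ℤ[X] => p.coeff 0) h
    simp only [coeff_zero_reverse, coeff_zero, leadingCoeff_eq_zero] at this
    exact hP0 this
  have hR0 : R ≠ 0 := by
    rintro rfl
    rw [mul_zero] at hR
    exact hrev0 hR
  -- degrees: `deg P* ≤ deg P` forces `R` constant
  have hdegR : R.natDegree = 0 := by
    have h1 : P.reverse.natDegree = P.natDegree + R.natDegree := by rw [hR, natDegree_mul hP0 hR0]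
    have h2 := reverse_natDegree_le P
    omega
  obtain ⟨r, hr⟩ : ∃ r : ℤ, R = C r := ⟨R.coeff 0, eq_C_of_natDegree_eq_zero hdegR⟩
  rw [hr] at hR
  -- compare constant and leading coefficients: `lc P = r · P(0)` and `P(0) = r · lc P`
  have htrail : P.natTrailingDegree = 0 := natTrailingDegree_eq_zero.mpr (Or.inr h0)
  have hc0 : P.leadingCoeff = P.coeff 0 * r := by
    have := congrArg (fun p : ℤ[X] => p.coeff 0) hR
    simp only [coeff_zero_reverse, coeff_mul_C] at this
    exact this
  have hlc : P.coeff 0 = P.leadingCoeff * r := by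
    have := congrArg Polynomial.leadingCoeff hR
    rw [leadingCoeff_mul, leadingCoeff_C, reverse_leadingCoeff, trailingCoeff, htrail] at this
    exact this
  have hr1 : r * r = 1 := by
    have h3 : P.coeff 0 * (r * r - 1) = 0 := by
      have : P.coeff 0 = P.coeff 0 * r * r := by rw [← hc0]; exact hlc
      linear_combination -this
    rcases mul_eq_zero.mp h3 with h | h
    · exact absurd h h0
    · linarith
  rcases Int.eq_one_or_neg_one_of_mul_eq_one hr1 with h | h
  · left
    rw [hR, h, map_one, mul_one]
  · right
    rw [hR, h, map_neg, map_one, mul_neg, mul_one]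

/-- **[McKee–Smyth, Exercise 12.15]** An irreducible `P ∈ ℤ[X]` with a complex zero of modulus `1` is
self-reciprocal: `P.reverse = P` or `P.reverse = -P`. -/
theorem reverse_eq_or_eq_neg_of_irreducible_of_unimodular_root {P : ℤ[X]} (hirr : Irreducible P)
    {α : ℂ} (hα : ‖α‖ = 1) (hP : aeval α P = 0) : P.reverse = P ∨ P.reverse = -P := by
  -- `P` has positive degree (it has a root) and `P(0) ≠ 0` (else `P = ±X`, which has no unimodular root)
  have hdeg : 0 < P.natDegree := by
    by_contra hd
    push Not at hd
    have hc := eq_C_of_natDegree_eq_zero (Nat.le_zero.mp hd)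
    rw [hc, aeval_C, algebraMap_int_eq, eq_intCast, Int.cast_eq_zero] at hP
    rw [hc, hP, map_zero] at hirr
    exact not_irreducible_zero hirr
  have h0 : P.coeff 0 ≠ 0 := by
    intro h
    have hX : X ∣ P := X_dvd_iff.mpr h
    have hass : Associated X P := irreducible_X.associated_of_dvd hirr hX
    obtain ⟨u, hu⟩ := hass
    obtain ⟨c, -, hcu⟩ := Polynomial.isUnit_iff.mp u.isUnit
    have hα0 : α = 0 := by
      rw [← hu, ← hcu, map_mul, aeval_X, aeval_C, mul_eq_zero] at hP
      rcases hP with h | h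
      · exact h
      · exfalso
        rw [algebraMap_int_eq, eq_intCast, Int.cast_eq_zero] at h
        rw [h, map_zero] at hcu
        exact u.ne_zero hcu.symm
    rw [hα0, norm_zero] at hα
    exact zero_ne_one hα
  exact reverse_eq_or_eq_neg_of_dvd_reverse h0
    (dvd_of_aeval_eq_zero_of_irreducible hirr hdeg hP (aeval_reverse_eq_zero_of_norm_eq_one hα hP))

/-- **[McKee–Smyth, Exercises 12.15 and A.5]** An irreducible `P ∈ ℤ[X]` of degree `≥ 2` with a complex
zero of modulus `1` is reciprocal with palindromic coefficients (`P.reverse = P`) and has even degree.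
(`P.reverse = -P` would give `P(1) = 0`, and odd degree would give `P(-1) = 0`, contradicting
irreducibility in degree `≥ 2`.) -/
theorem reverse_eq_self_of_irreducible_of_unimodular_root {P : ℤ[X]} (hirr : Irreducible P)
    (hdeg : 2 ≤ P.natDegree) {α : ℂ} (hα : ‖α‖ = 1) (hP : aeval α P = 0) :
    P.reverse = P ∧ Even P.natDegree := by
  -- an irreducible polynomial of degree ≥ 2 has no integer root
  have hnoroot : ∀ t : ℤ, P.eval t ≠ 0 := by
    intro t ht
    have hdvd : X - C t ∣ P := dvd_iff_isRoot.mpr ht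
    have hass : Associated (X - C t) P := (irreducible_X_sub_C t).associated_of_dvd hirr hdvd
    have h1 := natDegree_eq_of_degree_eq (degree_eq_degree_of_associated hass)
    rw [natDegree_X_sub_C] at h1
    omega
  rcases reverse_eq_or_eq_neg_of_irreducible_of_unimodular_root hirr hα hP with hrev | hrev
  · refine ⟨hrev, ?_⟩
    by_contra hodd
    rw [Nat.not_even_iff_odd] at hodd
    exact hnoroot (-1) (eval_neg_one_eq_zero_of_reverse_eq hrev hodd)
  · exact absurd (eval_one_eq_zero_of_reverse_eq_neg hrev) (hnoroot 1)

end Summit.Ventures.DiscreteObjects.Mahler
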